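import Literature.Barriers.RiemannHypothesis.TuranPartialSumsShiftLowSound
import Literature.Barriers.RiemannHypothesis.TuranPartialSumsShiftLowRun1
import Literature.Barriers.RiemannHypothesis.TuranPartialSumsShiftLowRun2
import Literature.Barriers.RiemannHypothesis.TuranPartialSumsShiftLowRun3
import HarnessLib

/-!
# Sections of `ζ` beyond `σ = 1`: every `ζ_N`, `1000 < N < 360000`, has a zero with `σ > 1`

Barrier catalogue `Literature/Barriers/RiemannHypothesis/`. Assembly of the block certificates:
the three certified runs (`blocks1_ok`, `blocks2_ok`, `blocks3_ok`) accept the `99` blocks of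
`TuranPartialSumsShiftLowBlocks.lean`; the blocks are consecutive and cover `1001 ≤ N ≤ 359999`
(`exists_blk`); the soundness theorem `exists_zero_of_checkBlks` turns acceptance into a zero of
`ζ_N(s) = ∑_{n ≤ N} n^{-s}` with `Re s > 1`.

## Main result

* `exists_zero_re_gt_one_of_low : 1000 < N → N < 360000 → ∃ s, 1 < s.re ∧ zetaPartialSum N s = 0`.

Axioms: `propext`, `Classical.choice`, `Quot.sound` and the three `native_decide` auxiliary axioms
of `blocks1_ok`, `blocks2_ok`, `blocks3_ok` (trust in the Lean compiler; declared `computational`).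

## References

* The construction and all estimates are the tree's (`TuranPartialSumsShift*.lean`); the criterion
  is [PlattTrudgian2016, §2.2] as formalized in `TuranPartialSumsCriterion.lean`.
-/

noncomputable section

namespace Literature.Barriers.RiemannHypothesis

namespace TuranShift

namespace LowCert

/-- Consecutive blocks starting at `st`: `b₀.lo = st`, `bᵢ.lo ≤ bᵢ.hi`, `bᵢ₊₁.lo = bᵢ.hi + 1`.
[folklore] -/
def chained : ℕ → List Blk → Bool
  | _, [] => true
  | st, b :: rest => (b.lo == st) && decide (b.lo ≤ b.hi) && chained (b.hi + 1) rest

/-- **Consecutive blocks cover their range.** [folklore] -/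
theorem exists_blk_of_chained : ∀ (l : List Blk) (st N : ℕ) (hne : l ≠ []), chained st l = true →
    st ≤ N → N ≤ (l.getLast hne).hi → ∃ b ∈ l, b.lo ≤ N ∧ N ≤ b.hi
  | [], _, _, hne, _, _, _ => absurd rfl hne
  | b :: rest, st, N, _, hch, hst, hhi => by
    simp only [chained, Bool.and_eq_true, beq_iff_eq, decide_eq_true_eq] at hch
    obtain ⟨⟨hb, _⟩, hrest⟩ := hch
    by_cases hN : N ≤ b.hi
    · exact ⟨b, by simp, by omega, hN⟩
    · have hne' : rest ≠ [] := by
        intro h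
        subst h
        simp at hhi
        exact hN hhi
      have hhi' : N ≤ (rest.getLast hne').hi := by
        rwa [List.getLast_cons hne'] at hhi
      obtain ⟨c, hc, h1, h2⟩ := exists_blk_of_chained rest (b.hi + 1) N hne' hrest (by omega) hhi'
      exact ⟨c, List.mem_cons_of_mem _ hc, h1, h2⟩

/-- The blocks are consecutive from `1001`. [folklore] -/
theorem allBlocks_chained : chained 1001 allBlocks = true := by decide

/-- [folklore] -/
theorem allBlocks_ne_nil : allBlocks ≠ [] := by decide

/-- The last block ends at `359999`. [folklore] -/
theorem allBlocks_last : (allBlocks.getLast allBlocks_ne_nil).hi = 359999 := by decide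

/-- **The blocks cover `1001 ≤ N ≤ 359999`.** [folklore] -/
theorem exists_blk {N : ℕ} (h1 : 1000 < N) (h2 : N < 360000) : ∃ b ∈ allBlocks, b.lo ≤ N ∧ N ≤ b.hi :=
  exists_blk_of_chained allBlocks 1001 N allBlocks_ne_nil allBlocks_chained h1 (by rw [allBlocks_last]; omega)

/-- **Every section `ζ_N`, `1000 < N < 360000`, has a zero in the half-plane `σ > 1`** (the
vertical-shift phases `p^{-iτ}` on the primes `p ≤ P` of each block, certified at checkpoints and
propagated by the `1/(N+1)`-Lipschitz behaviour of `‖B‖` and `R`). [folklore] -/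
theorem exists_zero_re_gt_one_of_low {N : ℕ} (h1 : 1000 < N) (h2 : N < 360000) :
    ∃ s : ℂ, 1 < s.re ∧ zetaPartialSum N s = 0 := by
  obtain ⟨b, hb, hlo, hhi⟩ := exists_blk h1 h2
  unfold allBlocks at hb
  rcases List.mem_append.1 hb with hb12 | hb3
  · rcases List.mem_append.1 hb12 with hb1 | hb2
    · exact exists_zero_of_checkBlks blocks1_ok b hb1 N hlo hhi
    · exact exists_zero_of_checkBlks blocks2_ok b hb2 N hlo hhi
  · exact exists_zero_of_checkBlks blocks3_ok b hb3 N hlo hhi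

end LowCert

end TuranShift

end Literature.Barriers.RiemannHypothesis
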